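import Summits.HodgeConjecture.HodgeConjecture.Theorems.Ring2AbelianAllAndreLeraySplitting
import Summits.HodgeConjecture.HodgeConjecture.Theorems.Ring2AbelianAllAndreFibreClassExtremeDegrees
import Summits.HodgeConjecture.HodgeConjecture.Theorems.Ring2AbelianAllAndreFibreProductPencils
import Summits.HodgeConjecture.HodgeConjecture.Theorems.Ring2AbelianAllAndreDominatedPencils
import Literature.AlgebraicGeometry.HodgeTheory.GysinCleanBaseChange
import Literature.AlgebraicGeometry.HodgeTheory.GysinBaseChange
import HarnessLib

/-!
# Ring 2 · sub-cell AbelianAll (ALL ABELIAN VARIETIES), André axis, part XXXVII-b — ENDOMORPHISMS OF THE FIBRE SQUARE: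
# base change of an `S`-endomorphism along a fibre inclusion (`θ^* J_{t*} = J_{t*} θ_t^*`, EXACT), the partial multiplications
# `θ₁ = ν ×_S 1`, `θ₂ = 1 ×_S ν` of `𝒳 ×_S 𝒳`, their fibre charts `[N] × 1` (Künneth eigenvalues `Nᵘ`, `u ≤ m`), and their DEGREE `N^{2d}`

HONEST FRAMING (page 1, verbatim): **research route, not a corollary; conditional on HC_CM plus one named
minimal statement.** Cell line: research route conditional on HC_CM; not a corollary; Q11.4-sentence-2
already refuted in dim ≥ 3. Nothing in this file proves a case of the Hodge conjecture for an abelian variety; `HC_CM` does not occur in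
this file; item `Theses.RankFourFaces.CMToAbelian` (stmt-16267) OPEN and not closed here. Seat `pub-hodge-ring2-ab-andre-2`, gen 29;
brief (iii). Part XXXVII derives the middle relative Lefschetz block (ρ) of ring2-b05's `B⋆(𝒳)` assembly from the fibre square by weights;
this file is the geometry of the square `𝒴 = 𝒳 ×_S 𝒳` (part XXXIII-b) and of its two partial multiplications.

## What is proved (theorems only; no definition, no named fact, no sorry; `HC_CM` absent)

§1 **`map_complexGysin_fiberι_eq_of_endo` — BASE CHANGE OF AN `S`-ENDOMORPHISM ALONG A FIBRE, EXACTLY.** For a compact pencil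
`g : 𝒴 ⟶ S` of abelian `n`-folds, an `S`-endomorphism `θ` (`θ ≫ g = g`) and a restriction `θ_t` of `θ` to the fibre `Y_t`
(`θ_t ≫ J_t = J_t ≫ θ`): `θ^*(J_{t*} x) = J_{t*}(θ_t^* x)` for every `x ∈ Hᵃ(Y_t)` — the tree's clean base change (Fulton 6.2 (a)) gives the
identity up to ONE scalar `K`, and `K = 1` on the fibre class (`θ^*[Y_t] = [Y_t]`, part XXV-f). `exists_fiberEndo_restrict` (the restriction).
§2 THE PARTIAL MULTIPLICATIONS OF THE SQUARE `𝒴 = 𝒳 ×_S 𝒳` (projections `a`, `b`; pencil structure `b ≫ f`). `exists_squareEndo_fst` /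
`exists_squareEndo_snd`: for `ν ≫ f = f` there are `θ₁, θ₂ : 𝒴 ⟶ 𝒴` with `θ₁ ≫ a = a ≫ ν`, `θ₁ ≫ b = b`, resp. `θ₂ ≫ a = a`, `θ₂ ≫ b = b ≫ ν`;
`squareEndo_comp_eq` (they are over `S`), `squareEndo_comm` (`θ₁ θ₂ = θ₂ θ₁`: a map to the square is determined by its projections);
**`squareEndo_fst_chart` / `squareEndo_snd_chart`** — on the fibre `Y_t ≅ X_t × X_t` (part XXXIII-b's iso `E`) the restriction of `θ₁` is
`ν_t × 1` and that of `θ₂` is `1 × ν_t` (`E.hom ≫ θ_{1,t} = (ν_t ▷ X_t) ≫ E.hom`; test against `a`, `b`, cancel the monomorphism `J_t`).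
§3 KÜNNETH EIGENVALUES ON THE FIBRE (any smooth projective `X`, any `φ : X ⟶ X` acting as `Nᵘ` on `Hᵘ(X)` — e.g. `[N]` on an abelian variety):
`map_whiskerRight_cross` / `map_whiskerLeft_cross` (`(φ × 1)^*(x ⊠ y) = φ^*x ⊠ y`); **`aeval_prod_whiskerRight_eq_zero` /
`aeval_prod_whiskerLeft_eq_zero`** — `∏_{u=0}^{m} ((φ × 1)^* − Nᵘ) = 0` on `Hᵐ(X × X)` (cross products span: the tree's Künneth spanning
`kunnethSpan_complexBetti`); **`map_whiskerRight_top` / `map_whiskerLeft_top`** — `(φ × 1)^* = N^{2 dim X}` on the top degree `H^{4 dim X}(X × X)`.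
The degrees `θ_{1*} 1 = θ_{2*} 1 = N^{2d} · 1` and the bi-weight decomposition of the top Leray piece of the square follow in part XXXVII-c.

## Honest status

Fact-free geometry of the fibre square for a GIVEN fibrewise multiplication (θ∀ displayed); no node; nothing minimal; N104 untouched.
Consumers: parts XXXVII-c…f.

References: Fulton1998 (Thm. 6.2 (a), Prop. 1.7, §19.2); FultonYoungTableaux1997 (App. B §B.1 (5)–(7)); Hartshorne1977 (II.3 base extension);
MumfordAV1970 (§19: `[n]^* = nᵏ` on `Hᵏ`); HatcherAT2002 (§3.2 Thm. 3.15 Künneth, §3.3 Prop. 3.38); Kleiman1968AlgebraicCycles (§1.3 p. 374);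
DeningerMurre1991 (Thm. 3.1); Kunnemann1993 (§2).
-/

noncomputable section

set_option linter.dupNamespace false

namespace Summit.HodgeConjecture.HodgeConjecture.Ring2.AbelianAll

open CategoryTheory CategoryTheory.Limits AlgebraicGeometry MonoidalCategory CartesianMonoidalCategory
open Literature.AlgebraicGeometry Literature.AlgebraicGeometry.Motives
open Literature.AlgebraicGeometry.HodgeTheory
open Literature.AlgebraicTopology.SingularHomology (singularCohomology cupProduct cupProduct_map cupPairing cupPairing_apply
  singularCohomologyZeroEquiv)

/-! ## §1 Base change of an `S`-endomorphism along a fibre inclusion — exactly -/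

section FibreBaseChange

variable {𝒴 S : SchemeOver ℂ} {n : ℕ} {g : 𝒴 ⟶ S}

/-- **An `S`-endomorphism restricts to every fibre**: `θ ≫ g = g ⟹ ∃ θ_t : Y_t ⟶ Y_t` with `θ_t ≫ J_t = J_t ≫ θ` (part XV-b's
`exists_fiberEndo_of_comp_eq`, restated). [cite: Hartshorne1977, II §3 (base extension)] -/
theorem exists_fiberEndo_restrict (θ : 𝒴 ⟶ 𝒴) (hθ : θ ≫ g = g) (t : ComplexPoints S) :
    ∃ θt : fiberOver g t ⟶ fiberOver g t, θt ≫ fiberι g t = fiberι g t ≫ θ :=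
  exists_fiberEndo_of_comp_eq g θ hθ t

/-- **BASE CHANGE OF AN `S`-ENDOMORPHISM ALONG A FIBRE INCLUSION, EXACTLY: `θ^*(J_{t*} x) = J_{t*}(θ_t^* x)`.** For a compact pencil
`g : 𝒴 ⟶ S` of abelian `n`-folds, `θ ≫ g = g` and a restriction `θ_t ≫ J_t = J_t ≫ θ`: the square `(θ_t, J_t; J_t, θ)` is the fibre square
of `θ` over `J_t` (a point `Q` of `𝒴` with `θ(Q) ∈ Y_t` lies on `Y_t`), of the expected dimensions, so the tree's clean base change gives
`θ^* J_{t*} = K · J_{t*} θ_t^*` for ONE scalar `K` (Fulton Thm. 6.2 (a) in the conventions of the complex orientations); on `x = 1` both sides are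
the fibre class (`θ^*[Y_t] = [Y_t]`, part XXV-f `map_complexGysin_fiberι_one`; `[Y_t] ≠ 0`, part XI), so `K = 1`.
[cite: Fulton1998, Thm. 6.2 (a) and Prop. 1.7] [cite: FultonYoungTableaux1997, Appendix B §B.1 (5)–(7)] -/
theorem map_complexGysin_fiberι_eq_of_endo (hg : IsCompactAbelianPencil g n) (t : ComplexPoints S) (θ : 𝒴 ⟶ 𝒴) (hθ : θ ≫ g = g)
    (θt : fiberOver g t ⟶ fiberOver g t) (hθt : θt ≫ fiberι g t = fiberι g t ≫ θ)
    {a b : ℕ} (hab : a + 2 * (n + 1) = b + 2 * n) (x : complexBetti (fiberOver g t) a) :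
    complexBetti.map θ b (complexGysin complexOrientationFamily (hg.isSmoothProjective_fiberOver t) hg.isSmoothProjective_total
      (fiberι g t) hab x) =
      complexGysin complexOrientationFamily (hg.isSmoothProjective_fiberOver t) hg.isSmoothProjective_total (fiberι g t) hab
        (complexBetti.map θt a x) := by
  have hYt := hg.isSmoothProjective_fiberOver t
  have hY := hg.isSmoothProjective_total
  haveI : IsSeparated S.hom := hg.isSmoothProjective_base.isProjectiveOver.isProper.toIsSeparated
  haveI : IsClosedImmersion (fiberι g t).left := Motives.isClosedImmersion_fiberι_left g t
  -- `(θ_t, J_t)` is a closed immersion (its second component is)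
  haveI : IsClosedImmersion (lift θt (fiberι g t)).left := by
    haveI : IsProper (fiberOver g t).hom := IsSmoothProjective.isProper_holds hYt
    haveI : IsSeparated (snd (fiberOver g t) 𝒴).left :=
      inferInstanceAs (IsSeparated (Limits.pullback.snd (fiberOver g t).hom 𝒴.hom))
    have h : (lift θt (fiberι g t)).left ≫ (snd (fiberOver g t) 𝒴).left = (fiberι g t).left := by
      rw [← Over.comp_left, lift_snd]
    haveI : IsClosedImmersion ((lift θt (fiberι g t)).left ≫ (snd (fiberOver g t) 𝒴).left) := by
      rw [h]; infer_instance
    exact IsClosedImmersion.of_comp _ (snd (fiberOver g t) 𝒴).left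
  -- incidence: a point `Q` of `𝒴` with `θ Q = J_t P` lies on `Y_t`
  have hinc : ∀ (P : ComplexPoints (fiberOver g t)) (Q : ComplexPoints 𝒴),
      AlgPoints.map (fiberι g t) P = AlgPoints.map θ Q →
      ∃ R : ComplexPoints (fiberOver g t), AlgPoints.map θt R = P ∧ AlgPoints.map (fiberι g t) R = Q := by
    intro P Q hPQ
    have hQ : Q ∈ AlgPoints.map g ⁻¹' {t} := by
      change AlgPoints.map g Q = t
      rw [← hθ, AlgPoints.map_comp_apply, ← hPQ, AlgPoints.map_map_fiberι]
    rw [← AlgPoints.range_map_fiberι] at hQ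
    obtain ⟨R, rfl⟩ := hQ
    refine ⟨R, AlgPoints.map_injective (fiberι g t) ?_, rfl⟩
    rw [← AlgPoints.map_comp_apply, hθt, AlgPoints.map_comp_apply, hPQ]
  obtain ⟨K, hK⟩ := complexGysin_cleanBaseChange complexOrientationFamily hYt hY hY hYt (fiberι g t) θ θt (fiberι g t)
    (by omega) hinc
  -- `K = 1` on the fibre class
  have h1 := hK (show 0 + 2 * (n + 1) = 2 + 2 * n by ring) (singularCohomology.one ℂ (ComplexPoints (fiberOver g t)))
  rw [map_complexGysin_fiberι_one hg t θ hθ] at h1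
  have hone : complexBetti.map θt 0 (singularCohomology.one ℂ (ComplexPoints (fiberOver g t))) =
      singularCohomology.one ℂ (ComplexPoints (fiberOver g t)) := singularCohomology.map_one _
  rw [hone] at h1
  have hne : complexGysin complexOrientationFamily hYt hY (fiberι g t) (show 0 + 2 * (n + 1) = 2 + 2 * n by ring)
      (singularCohomology.one ℂ (ComplexPoints (fiberOver g t))) ≠ 0 := fiberGysin_one_ne_zero hg t
  have hK1 : K = 1 := by
    have h : (K - 1) • complexGysin complexOrientationFamily hYt hY (fiberι g t) (show 0 + 2 * (n + 1) = 2 + 2 * n by ring)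
        (singularCohomology.one ℂ (ComplexPoints (fiberOver g t))) = 0 := by
      rw [sub_smul, one_smul, ← h1, sub_self]
    exact sub_eq_zero.1 ((smul_eq_zero.1 h).resolve_right hne)
  have h := hK hab x
  rwa [hK1, one_smul] at h

end FibreBaseChange

/-! ## §2 The partial multiplications `θ₁ = ν ×_S 1`, `θ₂ = 1 ×_S ν` of the fibre square -/

section Square

variable {𝒳 S : SchemeOver ℂ} {d : ℕ} {f : 𝒳 ⟶ S}

/-- `𝒴` — the fibre square `𝒳 ×_S 𝒳` (display notation for the tree's `familyPullback f f`). -/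
local notation3 (prettyPrint := false) "𝒴[" f "]" => familyPullback f f
/-- `𝐚` — the first projection `𝒳 ×_S 𝒳 ⟶ 𝒳`. -/
local notation3 (prettyPrint := false) "𝐚[" f "]" => familyPullback.fst f f
/-- `𝐛` — the second projection `𝒳 ×_S 𝒳 ⟶ 𝒳` (the pencil structure of the square is `𝐛 ≫ f`). -/
local notation3 (prettyPrint := false) "𝐛[" f "]" => familyPullback.snd f f

/-- **`θ₁ = ν ×_S 1`**: for `ν ≫ f = f` there is an endomorphism `θ₁` of `𝒳 ×_S 𝒳` with `θ₁ ≫ a = a ≫ ν` and `θ₁ ≫ b = b` (part XXV-d's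
base change of an `S`-endomorphism, along `f` itself). [cite: Hartshorne1977, II §3 (base extension)] -/
theorem exists_squareEndo_fst (ν : 𝒳 ⟶ 𝒳) (hν : ν ≫ f = f) :
    ∃ θ₁ : 𝒴[f] ⟶ 𝒴[f], θ₁ ≫ 𝐚[f] = 𝐚[f] ≫ ν ∧ θ₁ ≫ 𝐛[f] = 𝐛[f] := by
  obtain ⟨θ, h₁, h₂⟩ := exists_familyPullback_endo f f ν hν
  exact ⟨θ, h₂, h₁⟩

/-- **`θ₂ = 1 ×_S ν`**: for `ν ≫ f = f` there is an endomorphism `θ₂` of `𝒳 ×_S 𝒳` with `θ₂ ≫ a = a` and `θ₂ ≫ b = b ≫ ν`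
(`θ₂ = (a, b ≫ ν)`). [cite: Hartshorne1977, II §3 (base extension)] -/
theorem exists_squareEndo_snd (ν : 𝒳 ⟶ 𝒳) (hν : ν ≫ f = f) :
    ∃ θ₂ : 𝒴[f] ⟶ 𝒴[f], θ₂ ≫ 𝐚[f] = 𝐚[f] ∧ θ₂ ≫ 𝐛[f] = 𝐛[f] ≫ ν := by
  have hP := familyPullback.isPullback f f
  refine ⟨hP.lift (𝐚[f]) (𝐛[f] ≫ ν) (by rw [Category.assoc, hν, familyPullback.condition]), hP.lift_fst _ _ _, hP.lift_snd _ _ _⟩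

/-- The square's endomorphisms are over `S`: `θ ≫ (b ≫ f) = b ≫ f` when `θ ≫ b = b ≫ ν` (or `= b`) and `ν ≫ f = f`. [folklore] -/
theorem squareEndo_comp_eq {ν : 𝒳 ⟶ 𝒳} (hν : ν ≫ f = f) {θ : 𝒴[f] ⟶ 𝒴[f]} (hθ : θ ≫ 𝐛[f] = 𝐛[f] ≫ ν) :
    θ ≫ (𝐛[f] ≫ f) = 𝐛[f] ≫ f := by
  rw [← Category.assoc, hθ, Category.assoc, hν]

/-- **`θ₁ θ₂ = θ₂ θ₁`** — a morphism into the fibre square is determined by its two projections. [folklore] -/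
theorem squareEndo_comm (ν : 𝒳 ⟶ 𝒳) {θ₁ θ₂ : 𝒴[f] ⟶ 𝒴[f]} (h1a : θ₁ ≫ 𝐚[f] = 𝐚[f] ≫ ν) (h1b : θ₁ ≫ 𝐛[f] = 𝐛[f])
    (h2a : θ₂ ≫ 𝐚[f] = 𝐚[f]) (h2b : θ₂ ≫ 𝐛[f] = 𝐛[f] ≫ ν) : θ₁ ≫ θ₂ = θ₂ ≫ θ₁ := by
  apply (familyPullback.isPullback f f).hom_ext
  · rw [Category.assoc, h2a, h1a, Category.assoc, h1a, ← Category.assoc, h2a]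
  · rw [Category.assoc, h2b, ← Category.assoc, h1b, Category.assoc, h1b, h2b]

/-- **THE FIBRE CHART OF `θ₁`: on `Y_t ≅ X_t × X_t` the restriction of `θ₁` is `ν_t × 1`.** With the iso `E : X_t ⊗ X_t ≅ Y_t` of part
XXXIII-b (`E ≫ J_t ≫ a = pr₁ ≫ j_t`, `E ≫ J_t ≫ b = pr₂ ≫ j_t`), a restriction `ν_t` of `ν` (`ν_t ≫ j_t = j_t ≫ ν`) and a restriction `θ_{1,t}` of
`θ₁` (`θ_{1,t} ≫ J_t = J_t ≫ θ₁`): `E.hom ≫ θ_{1,t} = (ν_t ▷ X_t) ≫ E.hom` (test against `a` and `b`; `J_t` is a monomorphism).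
[cite: Hartshorne1977, II §3 (base extension)] -/
theorem squareEndo_fst_chart (t : ComplexPoints S) (ν : 𝒳 ⟶ 𝒳) {θ₁ : 𝒴[f] ⟶ 𝒴[f]}
    (h1a : θ₁ ≫ 𝐚[f] = 𝐚[f] ≫ ν) (h1b : θ₁ ≫ 𝐛[f] = 𝐛[f])
    (E : fiberOver f t ⊗ fiberOver f t ≅ fiberOver (𝐛[f] ≫ f) t)
    (hEa : E.hom ≫ fiberι (𝐛[f] ≫ f) t ≫ 𝐚[f] = fst _ _ ≫ fiberι f t)
    (hEb : E.hom ≫ fiberι (𝐛[f] ≫ f) t ≫ 𝐛[f] = snd _ _ ≫ fiberι f t)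
    (νt : fiberOver f t ⟶ fiberOver f t) (hνt : νt ≫ fiberι f t = fiberι f t ≫ ν)
    (θt : fiberOver (𝐛[f] ≫ f) t ⟶ fiberOver (𝐛[f] ≫ f) t) (hθt : θt ≫ fiberι (𝐛[f] ≫ f) t = fiberι (𝐛[f] ≫ f) t ≫ θ₁)
    [IsSeparated S.hom] :
    E.hom ≫ θt = (νt ▷ fiberOver f t) ≫ E.hom := by
  haveI : IsClosedImmersion (fiberι (𝐛[f] ≫ f) t).left := Motives.isClosedImmersion_fiberι_left _ t
  haveI : Mono (fiberι (𝐛[f] ≫ f) t) :=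
    (Over.forget _).mono_of_mono_map (inferInstanceAs (Mono (fiberι (𝐛[f] ≫ f) t).left))
  rw [← cancel_mono (fiberι (𝐛[f] ≫ f) t)]
  apply (familyPullback.isPullback f f).hom_ext
  · calc (E.hom ≫ θt) ≫ fiberι (𝐛[f] ≫ f) t ≫ 𝐚[f] = E.hom ≫ (fiberι (𝐛[f] ≫ f) t ≫ 𝐚[f]) ≫ ν := by
          simp only [Category.assoc]; rw [← Category.assoc θt, hθt, Category.assoc, h1a]
      _ = fst _ _ ≫ νt ≫ fiberι f t := by rw [← Category.assoc, hEa, Category.assoc, hνt]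
      _ = ((νt ▷ fiberOver f t) ≫ E.hom) ≫ fiberι (𝐛[f] ≫ f) t ≫ 𝐚[f] := by
          rw [Category.assoc, hEa, whiskerRight_fst_assoc]
  · calc (E.hom ≫ θt) ≫ fiberι (𝐛[f] ≫ f) t ≫ 𝐛[f] = E.hom ≫ fiberι (𝐛[f] ≫ f) t ≫ 𝐛[f] := by
          simp only [Category.assoc]; rw [← Category.assoc θt, hθt, Category.assoc, h1b]
      _ = snd _ _ ≫ fiberι f t := hEb
      _ = ((νt ▷ fiberOver f t) ≫ E.hom) ≫ fiberι (𝐛[f] ≫ f) t ≫ 𝐛[f] := by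
          rw [Category.assoc, hEb, whiskerRight_snd_assoc]

/-- **THE FIBRE CHART OF `θ₂`: `E.hom ≫ θ_{2,t} = (X_t ◁ ν_t) ≫ E.hom`** (restriction of `1 ×_S ν` is `1 × ν_t`).
[cite: Hartshorne1977, II §3 (base extension)] -/
theorem squareEndo_snd_chart (t : ComplexPoints S) (ν : 𝒳 ⟶ 𝒳) {θ₂ : 𝒴[f] ⟶ 𝒴[f]}
    (h2a : θ₂ ≫ 𝐚[f] = 𝐚[f]) (h2b : θ₂ ≫ 𝐛[f] = 𝐛[f] ≫ ν)
    (E : fiberOver f t ⊗ fiberOver f t ≅ fiberOver (𝐛[f] ≫ f) t)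
    (hEa : E.hom ≫ fiberι (𝐛[f] ≫ f) t ≫ 𝐚[f] = fst _ _ ≫ fiberι f t)
    (hEb : E.hom ≫ fiberι (𝐛[f] ≫ f) t ≫ 𝐛[f] = snd _ _ ≫ fiberι f t)
    (νt : fiberOver f t ⟶ fiberOver f t) (hνt : νt ≫ fiberι f t = fiberι f t ≫ ν)
    (θt : fiberOver (𝐛[f] ≫ f) t ⟶ fiberOver (𝐛[f] ≫ f) t) (hθt : θt ≫ fiberι (𝐛[f] ≫ f) t = fiberι (𝐛[f] ≫ f) t ≫ θ₂)
    [IsSeparated S.hom] :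
    E.hom ≫ θt = (fiberOver f t ◁ νt) ≫ E.hom := by
  haveI : IsClosedImmersion (fiberι (𝐛[f] ≫ f) t).left := Motives.isClosedImmersion_fiberι_left _ t
  haveI : Mono (fiberι (𝐛[f] ≫ f) t) :=
    (Over.forget _).mono_of_mono_map (inferInstanceAs (Mono (fiberι (𝐛[f] ≫ f) t).left))
  rw [← cancel_mono (fiberι (𝐛[f] ≫ f) t)]
  apply (familyPullback.isPullback f f).hom_ext
  · calc (E.hom ≫ θt) ≫ fiberι (𝐛[f] ≫ f) t ≫ 𝐚[f] = E.hom ≫ fiberι (𝐛[f] ≫ f) t ≫ 𝐚[f] := by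
          simp only [Category.assoc]; rw [← Category.assoc θt, hθt, Category.assoc, h2a]
      _ = fst _ _ ≫ fiberι f t := hEa
      _ = ((fiberOver f t ◁ νt) ≫ E.hom) ≫ fiberι (𝐛[f] ≫ f) t ≫ 𝐚[f] := by
          rw [Category.assoc, hEa, whiskerLeft_fst_assoc]
  · calc (E.hom ≫ θt) ≫ fiberι (𝐛[f] ≫ f) t ≫ 𝐛[f] = E.hom ≫ (fiberι (𝐛[f] ≫ f) t ≫ 𝐛[f]) ≫ ν := by
          simp only [Category.assoc]; rw [← Category.assoc θt, hθt, Category.assoc, h2b]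
      _ = snd _ _ ≫ νt ≫ fiberι f t := by rw [← Category.assoc, hEb, Category.assoc, hνt]
      _ = ((fiberOver f t ◁ νt) ≫ E.hom) ≫ fiberι (𝐛[f] ≫ f) t ≫ 𝐛[f] := by
          rw [Category.assoc, hEb, whiskerLeft_snd_assoc]

end Square

/-! ## §3 The fibre chart on cohomology: `(ν_t × 1)^*` on `H^*(X_t × X_t)` (Künneth eigenvalues) -/

section FibreCohomology

variable {X : SchemeOver ℂ} {m₀ : ℕ}

/-- **`(φ ▷ X)^*(pr₁^* x ∪ pr₂^* y) = pr₁^*(φ^* x) ∪ pr₂^* y`.** [cite: HatcherAT2002, §3.2 Prop. 3.10] -/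
theorem map_whiskerRight_cross (φ : X ⟶ X) {i j k : ℕ} (h : i + j = k) (x : complexBetti X i) (y : complexBetti X j) :
    complexBetti.map (φ ▷ X) k (cupProduct h (complexBetti.map (fst X X) i x) (complexBetti.map (snd X X) j y)) =
      cupProduct h (complexBetti.map (fst X X) i (complexBetti.map φ i x)) (complexBetti.map (snd X X) j y) := by
  rw [cupProduct_map]
  change cupProduct h (complexBetti.map (φ ▷ X) i (complexBetti.map (fst X X) i x))
    (complexBetti.map (φ ▷ X) j (complexBetti.map (snd X X) j y)) = _
  rw [← complexBetti.map_comp_apply', ← complexBetti.map_comp_apply', whiskerRight_fst, whiskerRight_snd,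
    complexBetti.map_comp_apply']

/-- **`(X ◁ φ)^*(pr₁^* x ∪ pr₂^* y) = pr₁^* x ∪ pr₂^*(φ^* y)`.** [cite: HatcherAT2002, §3.2 Prop. 3.10] -/
theorem map_whiskerLeft_cross (φ : X ⟶ X) {i j k : ℕ} (h : i + j = k) (x : complexBetti X i) (y : complexBetti X j) :
    complexBetti.map (X ◁ φ) k (cupProduct h (complexBetti.map (fst X X) i x) (complexBetti.map (snd X X) j y)) =
      cupProduct h (complexBetti.map (fst X X) i x) (complexBetti.map (snd X X) j (complexBetti.map φ j y)) := by
  rw [cupProduct_map]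
  change cupProduct h (complexBetti.map (X ◁ φ) i (complexBetti.map (fst X X) i x))
    (complexBetti.map (X ◁ φ) j (complexBetti.map (snd X X) j y)) = _
  rw [← complexBetti.map_comp_apply', ← complexBetti.map_comp_apply', whiskerLeft_fst, whiskerLeft_snd,
    complexBetti.map_comp_apply']

/-- **KÜNNETH EIGENVALUES OF `φ × 1`.** If `φ^*` acts on `Hᵘ(X(ℂ); ℂ)` as `Nᵘ` for every `u` (e.g. `φ = [N]` on an abelian variety) and
`X` is smooth projective, then on `Hᵐ((X × X)(ℂ); ℂ)` the operator `T = (φ ▷ X)^*` satisfies `∏_{u=0}^{m} (T − Nᵘ) = 0`: cross products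
`pr₁^* x ∪ pr₂^* y` span (the tree's Künneth spanning `kunnethSpan_complexBetti`) and `T` acts on such a class with `x ∈ Hᵘ` as `Nᵘ`.
[cite: HatcherAT2002, §3.2 Thm. 3.15] [cite: MumfordAV1970, §19] -/
theorem aeval_prod_whiskerRight_eq_zero (hX : IsSmoothProjective m₀ X) (φ : X ⟶ X) (N : ℕ)
    (hφ : ∀ (u : ℕ) (x : complexBetti X u), complexBetti.map φ u x = ((N : ℂ) ^ u) • x) (m : ℕ) (w : complexBetti (X ⊗ X) m) :
    Polynomial.aeval (complexBetti.map (φ ▷ X) m).hom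
      (∏ u ∈ Finset.range (m + 1), (Polynomial.X - Polynomial.C ((N : ℂ) ^ u))) w = 0 := by
  have hspan := kunnethSpan_complexBetti hX hX m w
  refine Submodule.span_induction (p := fun w _ ↦ Polynomial.aeval (complexBetti.map (φ ▷ X) m).hom
      (∏ u ∈ Finset.range (m + 1), (Polynomial.X - Polynomial.C ((N : ℂ) ^ u))) w = 0) ?_ ?_ ?_ ?_ hspan
  · rintro _ ⟨i, j, h, x, y, rfl⟩
    have hi : i ∈ Finset.range (m + 1) := Finset.mem_range.2 (by omega)
    rw [← Finset.prod_erase_mul _ _ hi, map_mul, Module.End.mul_apply, map_sub, Polynomial.aeval_X, Polynomial.aeval_C,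
      LinearMap.sub_apply, Module.algebraMap_end_apply]
    change Polynomial.aeval (complexBetti.map (φ ▷ X) m).hom _
      (complexBetti.map (φ ▷ X) m (cupProduct h (complexBetti.map (fst X X) i x) (complexBetti.map (snd X X) j y)) -
        ((N : ℂ) ^ i) • cupProduct h (complexBetti.map (fst X X) i x) (complexBetti.map (snd X X) j y)) = 0
    rw [map_whiskerRight_cross φ h x y, hφ i x, map_smul, LinearMap.map_smul₂, sub_self, map_zero]
  · exact map_zero _
  · intro x y _ _ hx hy
    rw [map_add, hx, hy, add_zero]
  · intro c x _ hx
    rw [map_smul, hx, smul_zero]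

/-- **KÜNNETH EIGENVALUES OF `1 × φ`**: `∏_{u=0}^{m} ((X ◁ φ)^* − Nᵘ) = 0` on `Hᵐ((X × X)(ℂ); ℂ)`. [cite: HatcherAT2002, §3.2 Thm. 3.15]
[cite: MumfordAV1970, §19] -/
theorem aeval_prod_whiskerLeft_eq_zero (hX : IsSmoothProjective m₀ X) (φ : X ⟶ X) (N : ℕ)
    (hφ : ∀ (u : ℕ) (x : complexBetti X u), complexBetti.map φ u x = ((N : ℂ) ^ u) • x) (m : ℕ) (w : complexBetti (X ⊗ X) m) :
    Polynomial.aeval (complexBetti.map (X ◁ φ) m).hom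
      (∏ u ∈ Finset.range (m + 1), (Polynomial.X - Polynomial.C ((N : ℂ) ^ u))) w = 0 := by
  have hspan := kunnethSpan_complexBetti hX hX m w
  refine Submodule.span_induction (p := fun w _ ↦ Polynomial.aeval (complexBetti.map (X ◁ φ) m).hom
      (∏ u ∈ Finset.range (m + 1), (Polynomial.X - Polynomial.C ((N : ℂ) ^ u))) w = 0) ?_ ?_ ?_ ?_ hspan
  · rintro _ ⟨i, j, h, x, y, rfl⟩
    have hj : j ∈ Finset.range (m + 1) := Finset.mem_range.2 (by omega)
    rw [← Finset.prod_erase_mul _ _ hj, map_mul, Module.End.mul_apply, map_sub, Polynomial.aeval_X, Polynomial.aeval_C,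
      LinearMap.sub_apply, Module.algebraMap_end_apply]
    change Polynomial.aeval (complexBetti.map (X ◁ φ) m).hom _
      (complexBetti.map (X ◁ φ) m (cupProduct h (complexBetti.map (fst X X) i x) (complexBetti.map (snd X X) j y)) -
        ((N : ℂ) ^ j) • cupProduct h (complexBetti.map (fst X X) i x) (complexBetti.map (snd X X) j y)) = 0
    rw [map_whiskerLeft_cross φ h x y, hφ j y, map_smul, map_smul, sub_self, map_zero]
  · exact map_zero _
  · intro x y _ _ hx hy
    rw [map_add, hx, hy, add_zero]
  · intro c x _ hx
    rw [map_smul, hx, smul_zero]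

/-- **`φ × 1` acts as `N^{2 dim X}` on the top degree `H^{4 dim X}((X × X)(ℂ); ℂ)`** (cross products of degree `(2 dim X, 2 dim X)` span the
top degree: in a pair `(i, j)` with `i + j = 4 dim X` either `i = j = 2 dim X` or one factor vanishes). [cite: HatcherAT2002, §3.2 Thm. 3.15, §3.3 Thm. 3.26]
[cite: MumfordAV1970, §19] -/
theorem map_whiskerRight_top (hX : IsSmoothProjective m₀ X) (φ : X ⟶ X) (N : ℕ)
    (hφ : ∀ (u : ℕ) (x : complexBetti X u), complexBetti.map φ u x = ((N : ℂ) ^ u) • x) (w : complexBetti (X ⊗ X) (4 * m₀)) :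
    complexBetti.map (φ ▷ X) (4 * m₀) w = ((N : ℂ) ^ (2 * m₀)) • w := by
  have hspan := kunnethSpan_complexBetti hX hX (4 * m₀) w
  refine Submodule.span_induction (p := fun w _ ↦ complexBetti.map (φ ▷ X) (4 * m₀) w = ((N : ℂ) ^ (2 * m₀)) • w) ?_ ?_ ?_ ?_ hspan
  · rintro _ ⟨i, j, h, x, y, rfl⟩
    by_cases hi : i = 2 * m₀
    · subst hi
      rw [map_whiskerRight_cross φ h x y, hφ, map_smul, LinearMap.map_smul₂]
    · rcases Nat.lt_or_gt_of_ne hi with hlt | hgt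
      · haveI := subsingleton_complexBetti hX (show 2 * m₀ < j by omega)
        rw [Subsingleton.elim y 0]
        simp only [map_zero, smul_zero]
      · haveI := subsingleton_complexBetti hX (show 2 * m₀ < i by omega)
        rw [Subsingleton.elim x 0]
        simp only [map_zero, LinearMap.zero_apply, smul_zero]
  · rw [map_zero, smul_zero]
  · intro x y _ _ hx hy
    rw [map_add, hx, hy, smul_add]
  · intro c x _ hx
    rw [map_smul, hx, smul_comm]

/-- **`1 × φ` acts as `N^{2 dim X}` on the top degree of `X × X`.** [cite: HatcherAT2002, §3.2 Thm. 3.15, §3.3 Thm. 3.26] [cite: MumfordAV1970, §19] -/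
theorem map_whiskerLeft_top (hX : IsSmoothProjective m₀ X) (φ : X ⟶ X) (N : ℕ)
    (hφ : ∀ (u : ℕ) (x : complexBetti X u), complexBetti.map φ u x = ((N : ℂ) ^ u) • x) (w : complexBetti (X ⊗ X) (4 * m₀)) :
    complexBetti.map (X ◁ φ) (4 * m₀) w = ((N : ℂ) ^ (2 * m₀)) • w := by
  have hspan := kunnethSpan_complexBetti hX hX (4 * m₀) w
  refine Submodule.span_induction (p := fun w _ ↦ complexBetti.map (X ◁ φ) (4 * m₀) w = ((N : ℂ) ^ (2 * m₀)) • w) ?_ ?_ ?_ ?_ hspan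
  · rintro _ ⟨i, j, h, x, y, rfl⟩
    by_cases hj : j = 2 * m₀
    · subst hj
      rw [map_whiskerLeft_cross φ h x y, hφ, map_smul, map_smul]
    · rcases Nat.lt_or_gt_of_ne hj with hlt | hgt
      · haveI := subsingleton_complexBetti hX (show 2 * m₀ < i by omega)
        rw [Subsingleton.elim x 0]
        simp only [map_zero, LinearMap.zero_apply, smul_zero]
      · haveI := subsingleton_complexBetti hX (show 2 * m₀ < j by omega)
        rw [Subsingleton.elim y 0]
        simp only [map_zero, smul_zero]
  · rw [map_zero, smul_zero]
  · intro x y _ _ hx hy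
    rw [map_add, hx, hy, smul_add]
  · intro c x _ hx
    rw [map_smul, hx, smul_comm]

end FibreCohomology

end Summit.HodgeConjecture.HodgeConjecture.Ring2.AbelianAll

end
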